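import Summits.Parity.GeneralizedHardyLittlewood.Theorems.FordMaynardNoSieveConst0164NegWitness0164SmallPeel
import Summits.Parity.GeneralizedHardyLittlewood.Theorems.FordMaynardNoSieveConst0164NegWitness0164KOne

/-!
# Route `FordMaynardNoSieveConst0164`, crux `NegWitness0164` (stmt-Parity-19102), line `birth`,
# stub `stub_tweakNeg0164`: the dimension `≥ 2` clause as the point `(1/2, 1/2)` plus five (fsl) families

Helper file toward the certificate stub (K. Ford, J. Maynard, *On the theory of prime producing sieves*,
arXiv:2407.14368, §8, proof of Theorem 2.7 (c): "it remains to show `f_{1,1}(1-α, α) ≥ -1` and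
`f_{2,1}(β₁, β₂, α) ≥ -1`").  With the (fsl) of the sibling file `…SmallPeel`
(`fragOp_eq_sum_sliceIntegral_of_others_small`) the reduction `stub_lower_of_0164` of `…TweakEmpty` becomes:
`h = tweak (1/2) (41/250) ∅ ∅ F₀ ≥ -1` in all dimensions `≥ 2` follows from

* `F₀ ≥ -1` at the small vectors of the support (all components in `[41/250, 1/2)`);
* the single value `fragOp (1/2) (41/250) F₀ (1/2, 1/2) ≥ -1` (the only vector of the support with two
  components `≥ 1/2`);
* for `s = 1, …, 5` and every `b ∈ [41/250, 1/2)^s` with `|b| ≤ 1/2`, writing `α = 1 - |b| ≥ 1/2`: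
  `f_{s,1}(b, α) = α ∑_{n=2}^{6} ∫_{v ∈ Δ_n(α)} 𝟙[v ≥ 41/250] 𝓛_{1/2}(v)/(n! ∏v) F₀(v, b) dv ≥ -1`
  (`sum_sliceIntegral_Icc_one_eq_Icc_two`: the one-piece term vanishes since `α ≥ 1/2`, Lemma 5.5 (a)).

`stub_tweakNeg0164_of_families` packages the whole stub this way: raw data `F₀` (symmetric, piecewise
Lipschitz, supported on `{ξᵢ ≥ 41/250, Σ ξ = 1}`) with `T₃(F₀) + S₅(F₀) + S₆(F₀) < -1` (`…KOne`) and the three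
displayed lower bounds prove `stub_tweakNeg0164` verbatim.  Def-free.

References: [FordMaynard2024PrimeSieves] arXiv:2407.14368, §8 (proof of Theorem 2.7 (c)), §6.1 (6.3)/(fsl).
-/

noncomputable section

open Finset MeasureTheory
open scoped Classical
open Literature.Combinatorics.Enumerative
open Literature.NumberTheory.Sieve Literature.NumberTheory.Sieve.FordMaynard

namespace Summit.Parity.GeneralizedHardyLittlewood.FordMaynardNoSieveConst0164NegWitness0164

/-- **The one-piece term of an (fsl) family vanishes**: for `α ≥ 1 - γ` (and `α ≥ 0`) the block `(α)` has
weight `𝓛_{1-γ}((α))/α = 0` (Lemma 5.5 (a)), so the sum over the number of pieces may start at `n = 2`.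
[cite: FordMaynard2024PrimeSieves, Lemma 5.5 (a) and Theorem 6.4 (fsl: "k_j ≥ 2")] -/
theorem sum_sliceIntegral_Icc_one_eq_Icc_two {γ η α : ℝ} (hα0 : 0 ≤ α) (hα : 1 - γ ≤ α) {N : ℕ}
    (G : (n : ℕ) → (Fin n → ℝ) → ℝ) :
    ∑ n ∈ Finset.Icc 1 N, sliceIntegral n α
        (fun v => if ∀ t, η ≤ v t then blockWeight γ n v * G n v else 0) =
      ∑ n ∈ Finset.Icc 2 N, sliceIntegral n α
        (fun v => if ∀ t, η ≤ v t then blockWeight γ n v * G n v else 0) := by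
  by_cases hN : 1 ≤ N
  · rw [show Finset.Icc 1 N = insert 1 (Finset.Icc 2 N) from by
        ext n; simp only [Finset.mem_insert, Finset.mem_Icc]; omega,
      Finset.sum_insert (by simp), sliceIntegral_one]
    have h1 : (if 0 < α then (fun v : Fin 1 → ℝ => if ∀ t, η ≤ v t then blockWeight γ 1 v * G 1 v else 0)
        (fun _ => α) else 0) = 0 := by
      beta_reduce
      split_ifs
      · rw [blockWeight_one_eq_zero_of_le (fun _ : Fin 1 => α) hα0 hα, zero_mul]
      · rfl
      · rfl
    rw [h1, zero_add]
  · rw [Finset.Icc_eq_empty (by omega), Finset.Icc_eq_empty (by omega)]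

/-- In dimension `2`, a vector of the simplex with a component `≥ 1/2` whose other component is also `≥ 1/2`
is `(1/2, 1/2)`. [folklore] -/
theorem eq_half_of_two {ξ : Fin 2 → ℝ} (hsum : ∑ i, ξ i = 1) (h0 : 1 / 2 ≤ ξ 0) (h1 : 1 / 2 ≤ ξ 1) :
    ξ = fun _ => 1 / 2 := by
  rw [Fin.sum_univ_two] at hsum
  funext i
  fin_cases i
  · show ξ 0 = 1 / 2; linarith
  · show ξ 1 = 1 / 2; linarith

/-- **The dimension `≥ 2` clause of `stub_tweakNeg0164`, as families.** For raw data `F₀ ∈ 𝒮`, piecewise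
Lipschitz in each dimension and supported on `{ξᵢ ≥ 41/250, Σ ξ = 1}`: if `F₀ ≥ -1` at the small vectors of
the support, `fragOp (1/2) (41/250) F₀ (1/2, 1/2) ≥ -1`, and for `s = 1, …, 5` and all `b ∈ [41/250, 1/2)^s`
with `|b| ≤ 1/2` the (fsl) family satisfies
`(1 - |b|) ∑_{n=2}^{6} ∫_{Δ_n(1-|b|)} 𝟙[v ≥ 41/250] w_n(v) F₀(v, b) dv ≥ -1`, then
`tweak (1/2) (41/250) ∅ ∅ F₀ ≥ -1` in every dimension `≥ 2`.
[cite: FordMaynard2024PrimeSieves, §8 (proof of Theorem 2.7 (c): "it remains to show f_{1,1} ≥ -1 and f_{2,1} ≥ -1")] -/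
theorem stub_lower_of_families_0164 {F₀ : VecFn} (hs : F₀.IsSymmetric)
    (hpl : ∀ k, IsPiecewiseLipschitz (F₀ k))
    (hsupp : ∀ (k : ℕ) (ξ : Fin k → ℝ), F₀ k ξ ≠ 0 → (∀ i, (41 / 250 : ℝ) ≤ ξ i) ∧ ∑ i, ξ i = 1)
    (hsmall : ∀ (k : ℕ) (ξ : Fin k → ℝ), (∀ i, (41 / 250 : ℝ) ≤ ξ i) → (∀ i, ξ i < 1 / 2) →
      ∑ i, ξ i = 1 → -1 ≤ F₀ k ξ)
    (hhalf : -1 ≤ fragOp (1 / 2) (41 / 250) F₀ 2 (fun _ => 1 / 2))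
    (hfam : ∀ s : ℕ, 1 ≤ s → s ≤ 5 → ∀ b : Fin s → ℝ, (∀ i, (41 / 250 : ℝ) ≤ b i) → (∀ i, b i < 1 / 2) →
      ∑ i, b i ≤ 1 / 2 →
      -1 ≤ (1 - ∑ i, b i) * ∑ n ∈ Finset.Icc 2 6, sliceIntegral n (1 - ∑ i, b i)
        (fun v => if ∀ t, (41 / 250 : ℝ) ≤ v t then
          blockWeight (1 / 2) n v * F₀ (n + s) (Fin.append v b) else 0)) :
    ∀ k : ℕ, 2 ≤ k → ∀ β : Fin k → ℝ, -1 ≤ tweak (1 / 2) (41 / 250) Fin.elim0 Fin.elim0 F₀ k β := by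
  obtain ⟨F, hF⟩ := exists_uniform_bound_of_support (by norm_num) hpl hsupp
  refine stub_lower_of_0164 hsmall fun k hk2 hk6 ξ hξ hsum ⟨j, hj⟩ => ?_
  obtain ⟨s, rfl⟩ : ∃ s, k = s + 1 := ⟨k - 1, by omega⟩
  by_cases hother : ∀ i, i ≠ j → ξ i < 1 / 2
  · -- all other coordinates are small: the (fsl) family of `b = ξ_{≠ j}`, `α = ξ_j = 1 - |b|`
    have hsplit : ξ j = 1 - ∑ i, ξ (j.succAbove i) := by
      rw [Fin.sum_univ_succAbove ξ j] at hsum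
      linarith
    rw [fragOp_eq_sum_sliceIntegral_of_others_small (by norm_num) (by norm_num) hs
      (fun n => (hpl n).measurable) hF ξ j (fun i hi => ⟨hξ i, by linarith [hother i hi]⟩), maxBlock_0164,
      sum_sliceIntegral_Icc_one_eq_Icc_two (by linarith) (by linarith), hsplit]
    exact hfam s (by omega) (by omega) _ (fun i => hξ _) (fun i => hother _ (Fin.succAbove_ne j i))
      (by linarith)
  · -- a second large coordinate: only `(1/2, 1/2)` in dimension `2`
    push Not at hother
    obtain ⟨i, hij, hi⟩ := hother
    have hs1 : s = 1 := by
      by_contra hs1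
      exact hij (large_unique (γ := 1 / 2) (by norm_num) (by norm_num : (0 : ℝ) < 41 / 250) hξ hsum
        (by omega) (by linarith) (by linarith))
    subst hs1
    have hξeq : ξ = fun _ => 1 / 2 := by
      fin_cases i <;> fin_cases j
      · exact absurd rfl hij
      · exact eq_half_of_two hsum hi hj
      · exact eq_half_of_two hsum hj hi
      · exact absurd rfl hij
    rw [hξeq]
    exact hhalf

/-- **`stub_tweakNeg0164` from four analytic inequalities on raw data.** Let `F₀ ∈ 𝒮` be piecewise Lipschitz
in each dimension and supported on `{ξᵢ ≥ 41/250, Σ ξ = 1}`. If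
(i) `T₃(F₀) + S₅(F₀) + S₆(F₀) < -1` (the `k = 1` clause, `tweak_one_eq_three_five_six_0164`),
(ii) `F₀ ≥ -1` at the small vectors of the support,
(iii) `fragOp (1/2) (41/250) F₀ (1/2, 1/2) ≥ -1`, and
(iv) the five (fsl) families of `stub_lower_of_families_0164` are `≥ -1`,
then `F₀` witnesses `stub_tweakNeg0164` (statement verbatim).
[cite: FordMaynard2024PrimeSieves, §8 (proof of Theorem 2.7 (c))] -/
theorem stub_tweakNeg0164_of_families (F₀ : VecFn) (hs : F₀.IsSymmetric)
    (hpl : ∀ k, IsPiecewiseLipschitz (F₀ k))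
    (hsupp : ∀ (k : ℕ) (ξ : Fin k → ℝ), F₀ k ξ ≠ 0 → (∀ i, (41 / 250 : ℝ) ≤ ξ i) ∧ ∑ i, ξ i = 1)
    (hone : sliceIntegral 3 1 (fun v => if (∀ t, (41 / 250 : ℝ) ≤ v t) ∧ (∀ t, v t < 1 / 2) then
          F₀ 3 v / (3 * (v 0 * v 1 * v 2)) else 0) +
        sliceIntegral 5 1
          (fun v => if ∀ t, (41 / 250 : ℝ) ≤ v t then blockWeight (1 / 2) 5 v * F₀ 5 v else 0) +
        sliceIntegral 6 1
          (fun v => if ∀ t, (41 / 250 : ℝ) ≤ v t then blockWeight (1 / 2) 6 v * F₀ 6 v else 0) < -1)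
    (hsmall : ∀ (k : ℕ) (ξ : Fin k → ℝ), (∀ i, (41 / 250 : ℝ) ≤ ξ i) → (∀ i, ξ i < 1 / 2) →
      ∑ i, ξ i = 1 → -1 ≤ F₀ k ξ)
    (hhalf : -1 ≤ fragOp (1 / 2) (41 / 250) F₀ 2 (fun _ => 1 / 2))
    (hfam : ∀ s : ℕ, 1 ≤ s → s ≤ 5 → ∀ b : Fin s → ℝ, (∀ i, (41 / 250 : ℝ) ≤ b i) → (∀ i, b i < 1 / 2) →
      ∑ i, b i ≤ 1 / 2 →
      -1 ≤ (1 - ∑ i, b i) * ∑ n ∈ Finset.Icc 2 6, sliceIntegral n (1 - ∑ i, b i)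
        (fun v => if ∀ t, (41 / 250 : ℝ) ≤ v t then
          blockWeight (1 / 2) n v * F₀ (n + s) (Fin.append v b) else 0)) :
    ∃ F₀ : VecFn, F₀.IsSymmetric ∧ (∀ k, IsPiecewiseLipschitz (F₀ k)) ∧
      (∀ (k : ℕ) (ξ : Fin k → ℝ), F₀ k ξ ≠ 0 → (∀ i, (41 / 250 : ℝ) ≤ ξ i) ∧ ∑ i, ξ i = 1) ∧
      tweak (1 / 2) (41 / 250) Fin.elim0 Fin.elim0 F₀ 1 (fun _ => 1) < -1 ∧
      ∀ k : ℕ, 2 ≤ k → ∀ β : Fin k → ℝ, -1 ≤ tweak (1 / 2) (41 / 250) Fin.elim0 Fin.elim0 F₀ k β :=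
  ⟨F₀, hs, hpl, hsupp, by rwa [tweak_one_eq_three_five_six_0164 hpl hsupp],
    stub_lower_of_families_0164 hs hpl hsupp hsmall hhalf hfam⟩

end Summit.Parity.GeneralizedHardyLittlewood.FordMaynardNoSieveConst0164NegWitness0164

end
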